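import Summits.QuantumFields.YangMills.Theorems.BalabanUVNodesSpineCarriersOfRecord13Sep
import Literature.MathematicalPhysics.QuantumFieldTheory.Balaban1983to89.Node00.Record13DatumKeySep

/-! ⁗ (SEPARATED-RANGE, rev 18∕19) EDITION OF dag-n20-d's `…SpineCarriersOfRecord13Keyed` (p490271's sibling; (T-SPINE)₁₃ LAYER A + THE CANONICAL KEY), filed FOR THE n20 LINEAGE by
dag-n19-d g7 as offer (E′) (INBOX l.17225; dag-n27-c g7 INTENT-2 l.17216 declared the (C)(D) twins and listed this file «NOT twinned — no consumer today»; consumer = n19-d's 23b⁗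
`…N19TargetAtHomes13Sep`).  PROVENANCE: statements AND proofs = n20-d's TREE BYTES token for token under def-T's v1.2 map (`Provisos₁₃∕datumOfRecord₁₃∕IsRecordOfRecord₁₃C ↦ …Sep`) + RR-2's
AFTER-C names (`IsDatumOfRecord₁₃CSep`, `canon₁₃Sep`, `exists_keyed_canon₁₃Sep_iff`, `Node00.Record13DatumKeySep`) + the spine-side stems (`SpineReading₁₃ ↦ …Sep`, `SRec₁₃ ↦ SRec₁₃Sep`,
`sRec₁₃… ↦ sRec₁₃Sep…`, `canonReading₁₃ ↦ canonReading₁₃Sep`, `readingOfAssignment₁₃ ↦ …Sep`); namespace UNCHANGED (`YMDAG.UVSplit`, theirs); θ-level `Node00.SpineAssignment₁₃` NOT twinned.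
K3⁗ `SpineGivenEndpointR13Sep` = stmt-QuantumFields-20292; `--kind definition --supports 20292 --as helper` (two defs).  COUNT-NEUTRAL; nothing of Bałaban's asserted; no Sep inhabitant claimed.
Below: n20-d's header under the map. -/
/-!
# THE SPINE-CARRIER PREDICATE OF RECORD AT STAGE 13, KEYED — layer A of the rate-record home at ₁₃ (node00-def-RR-2's residual `Node00.SpineAssignment₁₃` READ AS
# a reading) and THE CANONICAL KEY (`YMDAG.UVSplit.canonReading₁₃Sep`: a reading READ THROUGH RR-2's `Node00.canon₁₃Sep` pins ONE bundle per datum of record, at its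
# canonical parameter `Node00.IsDatumOfRecord₁₃CSep.params` — the SAME parameter (T-RATE)'s datum-keyed `RRec₁₃Sep` reads); the ₁₃ twin of
# `BalabanUVNodesSpineCarriersOfRecord12Keyed` (p466628), sibling of `BalabanUVNodesSpineCarriersOfRecord13Sep` (the 400-line rule)

Track A of `YM-PLAN.md` (cell `pub-ymgap`, HUMAN RULING D-0062); seat `pub-ymgap-dag-n20-d` (generation 4), module 5 of the ₁₃ re-key of the n20 lineage
(director-ym LINE №125 «RECORD 13»; node00-def-RR-2's `R13-KEY-TOKEN-MAP.md` «n20-d pens»); RR-2's `Node00/Record13DatumKeySep.lean` (`IsDatumOfRecord₁₃CSep`,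
`.params ∕ .provisos ∕ .admissible`, `canon₁₃Sep`, `exists_keyed_canon₁₃Sep_iff`, `SpineAssignment₁₃`, `SpineAssignment₁₃.ofStage12 ∕ .ofStage9`) consumed BY NAME,
nothing re-typed.  Definition lane (two `def`s); every theorem kernel bookkeeping; 0 `sorry`, standard axioms.  COUNT-NEUTRAL; `--supports` K3′
(stmt-QuantumFields-19908, `--as helper`) until the rev-16 ids over `Stage13Params` exist.  Restate-immune (no Theses import).

WHAT THIS MODULE PROVES (all [bookkeeping]; the ₁₂ module with `12 ↦ 13` plus the `.ofStage12` lift face).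
* §1 LAYER A AT ₁₃: `readingOfAssignment₁₃Sep 𝔰` · `sRec₁₃Sep_assignment_iff` (`Iff.rfl`) · `s_N20 ∕ s_N21 ∕ s_N19 ∕ s_U4_sRec₁₃Sep_assignment_iff` ·
  `readingOfAssignment₁₃Sep_ofStage9_apply` · `readingOfAssignment₁₃Sep_ofStage12_apply` (a Stage-12-typed assignment lifts, `rfl`).
* §2 THE CANONICAL KEY AT ₁₃: `canonReading₁₃Sep cr` · `sRec₁₃Sep_canon_iff` (RR-2's `exists_keyed_canon₁₃Sep_iff` at `Φ x := S = x g₀ os`) · `sRec₁₃Sep_canon_unique` ·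
  `s_N20_sRec₁₃Sep_canon_iff` · `s_N20_sRec₁₃Sep_canon_of_sRec₁₃Sep` · `sRec₁₃Sep_canon_of_isRecordOfRecord₁₃CSep`.

HONEST FRAMING.  PINS ONLY; nothing of Bałaban's is asserted or instantiated; NE7 ∕ NE7b ∕ NE7c NOT PRINTED for d = 4, NOT PROVED; no inhabitant of
`IsRecordOfRecord₁₃CSep` ∕ `IsDatumOfRecord₁₃CSep` claimed (K0‴ open); N19 ∕ N20 ∕ N21 ∕ N27 NOT discharged (0∕1 at every record); typed 28∕28, discharged count
untouched; one finite four-torus programme at fixed `ε` — NOT ℝ⁴, NOT infinite volume, NOT OS, NOT a mass gap, NOT Clay.  No decl below carries a cite tag.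
-/


open Finset

namespace YMDAG.UVSplit

open Literature.MathematicalPhysics.QuantumFieldTheory.Balaban1983to89
open Literature.MathematicalPhysics.QuantumFieldTheory.Balaban1983to89.T4Continuum
open T4WeightBudget (RelWeightBound)
open T4IndicatorShell (ShellWeightBound)
open Summit.QuantumFields.BalabanUV.T4Continuum.Spine
open Node00 (Stage13Params datumOfRecord₁₃Sep IsRecordOfRecord₁₃CSep)

variable {N : ℕ} [NeZero N] (cr : SpineReading₁₃Sep N)

/-! ## §1 LAYER A AT ₁₃ — node00-def-RR-2's `Node00/Record13DatumKeySep.lean`: the residual `Node00.SpineAssignment₁₃ N` READ AS a reading (RR-1's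
stage-free objects `Node00.SpineObjects₁₁`, carried to `SpineCarriers` by p456575's `spineOfObjects₁₁`, REUSED by import); the instances restated at the
assignment's own fields -/

section LayerA

/-- **THE READING OF A RESIDUAL STAGE-13 SPINE ASSIGNMENT** `𝔰 : Node00.SpineAssignment₁₃ N` (RR-2: `(F, θ, g₀, os) ↦ SpineObjects₁₁`, proviso-free):
`(F, θ, hP, g₀, os) ↦ spineOfObjects₁₁ (𝔰 F θ g₀ os)` — the provisos proof is not read.  `SRec₁₃Sep (readingOfAssignment₁₃Sep 𝔰)` is layer A's «`SRec₁₃Sep 𝔰`». [bookkeeping] -/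
def readingOfAssignment₁₃Sep (𝔰 : Node00.SpineAssignment₁₃ N) : SpineReading₁₃Sep N :=
  fun F θ _ g₀ os => spineOfObjects₁₁ (𝔰 F θ g₀ os)

variable (𝔰 : Node00.SpineAssignment₁₃ N)

/-- Unfolding at an assignment (`Iff.rfl`). [bookkeeping] -/
theorem sRec₁₃Sep_assignment_iff {F : T4Family} (D : Datum F N) (g₀ : ℕ → ℝ) (os : List (ULoop F)) (S : SpineCarriers) :
    SRec₁₃Sep (readingOfAssignment₁₃Sep 𝔰) F D g₀ os S ↔
      ∃ (θ : Stage13Params F N) (hP : θ.Provisos₁₃Sep F N), θ.Admissible F N ∧ D = datumOfRecord₁₃Sep F N θ hP ∧ S = spineOfObjects₁₁ (𝔰 F θ g₀ os) :=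
  Iff.rfl

/-- **N20 AT LAYER A's OBJECTS, STAGE 13**: `S_N20 (SRec₁₃Sep (readingOfAssignment₁₃Sep 𝔰))` ⟺ «for every admissible Stage-13 θ with provisos, every `g₀`, `os`:
NE7b's `RelWeightBound` at the FIELDS `l₀, T, A, B, Bad, W` of `𝔰 F θ g₀ os`» (`s_N20_sRec₁₃Sep_iff`, fields by `rfl`). [bookkeeping] -/
theorem s_N20_sRec₁₃Sep_assignment_iff :
    S_N20 (SRec₁₃Sep (readingOfAssignment₁₃Sep 𝔰)) ↔ ∀ (F : T4Family) (θ : Stage13Params F N) (_ : θ.Provisos₁₃Sep F N), θ.Admissible F N →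
      ∀ (g₀ : ℕ → ℝ) (os : List (ULoop F)),
        RelWeightBound (𝔰 F θ g₀ os).l₀ (𝔰 F θ g₀ os).T (𝔰 F θ g₀ os).A (𝔰 F θ g₀ os).B (𝔰 F θ g₀ os).Bad (𝔰 F θ g₀ os).W :=
  s_N20_sRec₁₃Sep_iff (readingOfAssignment₁₃Sep 𝔰)

/-- **N21 AT LAYER A's OBJECTS, STAGE 13** (fields `l₀, T, A, B, shA, shB, Wsh`). [bookkeeping] -/
theorem s_N21_sRec₁₃Sep_assignment_iff :
    S_N21 (SRec₁₃Sep (readingOfAssignment₁₃Sep 𝔰)) ↔ ∀ (F : T4Family) (θ : Stage13Params F N) (_ : θ.Provisos₁₃Sep F N), θ.Admissible F N →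
      ∀ (g₀ : ℕ → ℝ) (os : List (ULoop F)),
        ShellWeightBound (𝔰 F θ g₀ os).l₀ (𝔰 F θ g₀ os).T (𝔰 F θ g₀ os).A (𝔰 F θ g₀ os).B (𝔰 F θ g₀ os).shA (𝔰 F θ g₀ os).shB
          (𝔰 F θ g₀ os).Wsh :=
  s_N21_sRec₁₃Sep_iff (readingOfAssignment₁₃Sep 𝔰)

/-- **N19 AT LAYER A's OBJECTS, STAGE 13** (the cores `A − shA`, `B − shB`, the bad sets, `vol`, `δ`; `DecidableEq` = the record's `dec`). [bookkeeping] -/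
theorem s_N19_sRec₁₃Sep_assignment_iff (Inputs : InputsPred N) :
    S_N19 (SRec₁₃Sep (readingOfAssignment₁₃Sep 𝔰)) Inputs ↔ ∀ (F : T4Family) (θ : Stage13Params F N) (hP : θ.Provisos₁₃Sep F N), θ.Admissible F N →
      ∀ (g₀ : ℕ → ℝ) (os : List (ULoop F)), Inputs F (datumOfRecord₁₃Sep F N θ hP) g₀ os → letI := (𝔰 F θ g₀ os).dec
        NE7.Core (𝔰 F θ g₀ os).l₀ (𝔰 F θ g₀ os).vol (𝔰 F θ g₀ os).T (𝔰 F θ g₀ os).Bad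
          (fun K t τ => (𝔰 F θ g₀ os).A K t τ - (𝔰 F θ g₀ os).shA K t τ)
          (fun K t τ => (𝔰 F θ g₀ os).B K t τ - (𝔰 F θ g₀ os).shB K t τ) (𝔰 F θ g₀ os).δ :=
  s_N19_sRec₁₃Sep_iff (readingOfAssignment₁₃Sep 𝔰) Inputs

/-- **U4′ AT LAYER A's OBJECTS, STAGE 13** (fields `W, Wsh, δ`). [bookkeeping] -/
theorem s_U4_sRec₁₃Sep_assignment_iff :
    S_U4 (SRec₁₃Sep (readingOfAssignment₁₃Sep 𝔰)) ↔ ∀ (F : T4Family) (θ : Stage13Params F N) (_ : θ.Provisos₁₃Sep F N), θ.Admissible F N →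
      ∀ (g₀ : ℕ → ℝ) (os : List (ULoop F)), (∀ K, (𝔰 F θ g₀ os).W K + (𝔰 F θ g₀ os).Wsh K < 1) ∧ Summable (𝔰 F θ g₀ os).δ :=
  s_U4_sRec₁₃Sep_iff (readingOfAssignment₁₃Sep 𝔰)

/-- **A STAGE-9-TYPED ASSIGNMENT LIFTS** (RR-2's `SpineAssignment₁₃.ofStage9`): an assignment reading only the Stage-9 part of the tuple keys, at ₁₃, the reading
`(F, θ, hP, g₀, os) ↦ spineOfObjects₁₁ (s F θ.toStage9Params g₀ os)` (`rfl`). [bookkeeping] -/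
theorem readingOfAssignment₁₃Sep_ofStage9_apply (s : (F : T4Family) → Node00.Stage9Params F N → (ℕ → ℝ) → List (ULoop F) → Node00.SpineObjects₁₁)
    (F : T4Family) (θ : Stage13Params F N) (hP : θ.Provisos₁₃Sep F N) (g₀ : ℕ → ℝ) (os : List (ULoop F)) :
    readingOfAssignment₁₃Sep (Node00.SpineAssignment₁₃.ofStage9 N s) F θ hP g₀ os = spineOfObjects₁₁ (s F θ.toStage9Params g₀ os) :=
  rfl

/-- **A STAGE-12-TYPED ASSIGNMENT LIFTS** (RR-2's `SpineAssignment₁₃.ofStage12`): layer A's Stage-12 assignment keys, at ₁₃, the reading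
`(F, θ, hP, g₀, os) ↦ spineOfObjects₁₁ (s F θ.toStage12Params g₀ os)` (`rfl`) — the one-token lift of RR-2's map §2. [bookkeeping] -/
theorem readingOfAssignment₁₃Sep_ofStage12_apply (s : Node00.SpineAssignment₁₂ N) (F : T4Family) (θ : Stage13Params F N) (hP : θ.Provisos₁₃Sep F N)
    (g₀ : ℕ → ℝ) (os : List (ULoop F)) :
    readingOfAssignment₁₃Sep (Node00.SpineAssignment₁₃.ofStage12 N s) F θ hP g₀ os = spineOfObjects₁₁ (s F θ.toStage12Params g₀ os) :=
  rfl

end LayerA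

/-! ## §2 THE CANONICAL KEY AT ₁₃ — node00-def-RR-2's `Node00.canon₁₃Sep`: a reading READ THROUGH `canon₁₃Sep` pins ONE bundle per datum of record
(`Node00.IsDatumOfRecord₁₃CSep.params`), so spine and rate carriers keyed independently ((T-RATE)'s `RRec₁₃Sep 𝔯` is datum-keyed) are read AT THE SAME parameter -/

section Canon

/-- **THE CANONICALISED READING, STAGE 13**: `cr` read at the canonical Stage-13 parameter of the datum `datumOfRecord₁₃Sep F N θ hP` (RR-2's `Node00.canon₁₃Sep`, choice;
off the datum-of-record class it reads `cr` itself). [bookkeeping] -/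
noncomputable def canonReading₁₃Sep (cr : SpineReading₁₃Sep N) : SpineReading₁₃Sep N :=
  fun F θ hP => Node00.canon₁₃Sep F N (cr F) θ hP

/-- **THE DATUM-KEYED FACE**: keyed through the canonical reading, `SRec₁₃Sep` pins at `(F, D, g₀, os)` exactly the bundle `cr` reads at the CANONICAL parameter of
`D` — RR-2's `Node00.exists_keyed_canon₁₃Sep_iff` at `Φ x := (S = x g₀ os)`. [bookkeeping] -/
theorem sRec₁₃Sep_canon_iff {F : T4Family} (D : Datum F N) (g₀ : ℕ → ℝ) (os : List (ULoop F)) (S : SpineCarriers) :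
    SRec₁₃Sep (canonReading₁₃Sep cr) F D g₀ os S ↔ ∃ h : Node00.IsDatumOfRecord₁₃CSep F N D, S = cr F h.params h.provisos g₀ os :=
  Node00.exists_keyed_canon₁₃Sep_iff (f := cr F) (fun x => S = x g₀ os)

/-- **ONE BUNDLE PER DATUM**: through the canonical reading two pinned bundles at the same `(F, D, g₀, os)` coincide (proof irrelevance of the key). [bookkeeping] -/
theorem sRec₁₃Sep_canon_unique {F : T4Family} {D : Datum F N} {g₀ : ℕ → ℝ} {os : List (ULoop F)} {S S' : SpineCarriers}
    (h : SRec₁₃Sep (canonReading₁₃Sep cr) F D g₀ os S) (h' : SRec₁₃Sep (canonReading₁₃Sep cr) F D g₀ os S') : S = S' := by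
  obtain ⟨k, rfl⟩ := (sRec₁₃Sep_canon_iff cr D g₀ os S).mp h
  obtain ⟨k', rfl⟩ := (sRec₁₃Sep_canon_iff cr D g₀ os S').mp h'
  rfl

/-- **N20 THROUGH THE CANONICAL KEY, STAGE 13**: `S_N20 (SRec₁₃Sep (canonReading₁₃Sep cr))` ⟺ «at every Stage-13 datum of record, NE7b's `RelWeightBound` at the bundle
`cr` reads at the datum's CANONICAL parameter, for every `g₀`, `os`». [bookkeeping] -/
theorem s_N20_sRec₁₃Sep_canon_iff :
    S_N20 (SRec₁₃Sep (canonReading₁₃Sep cr)) ↔ ∀ (F : T4Family) (D : Datum F N) (h : Node00.IsDatumOfRecord₁₃CSep F N D) (g₀ : ℕ → ℝ) (os : List (ULoop F)),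
      RelWeightBound (cr F h.params h.provisos g₀ os).l₀ (cr F h.params h.provisos g₀ os).T (cr F h.params h.provisos g₀ os).A
        (cr F h.params h.provisos g₀ os).B (cr F h.params h.provisos g₀ os).Bad (cr F h.params h.provisos g₀ os).W := by
  constructor
  · intro hS F D h g₀ os
    exact hS F D g₀ os _ ((sRec₁₃Sep_canon_iff cr D g₀ os _).mpr ⟨h, rfl⟩)
  · intro hS F D g₀ os S hmem
    obtain ⟨h, rfl⟩ := (sRec₁₃Sep_canon_iff cr D g₀ os S).mp hmem
    exact hS F D h g₀ os

/-- **THE θ-FORM IMPLIES THE CANONICAL FORM, STAGE 13**: NE7b at `cr`'s reading of EVERY admissible tuple with provisos (`S_N20 (SRec₁₃Sep cr)`) gives it at the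
canonical parameters (`S_N20 (SRec₁₃Sep (canonReading₁₃Sep cr))`) — the canonical reading's image lies in `cr`'s (p450743 `s_N20_of_image`). [bookkeeping] -/
theorem s_N20_sRec₁₃Sep_canon_of_sRec₁₃Sep (h : S_N20 (SRec₁₃Sep cr)) : S_N20 (SRec₁₃Sep (canonReading₁₃Sep cr)) := by
  rw [s_N20_sRec₁₃Sep_canon_iff]
  intro F D hD g₀ os
  exact (s_N20_sRec₁₃Sep_iff cr).mp h F hD.params hD.provisos hD.admissible g₀ os

/-- **AT A STAGE-13 RECORD PAIR THE CANONICAL READING IS PINNED** (RR-2's `isDatumOfRecord₁₃CSep_of_isRecordOfRecord₁₃CSep`): for every `(g₀, os)` the bundle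
`cr F h.params h.provisos g₀ os` of the pair's datum key `h` is pinned at `D` by `SRec₁₃Sep (canonReading₁₃Sep cr)`. [bookkeeping] -/
theorem sRec₁₃Sep_canon_of_isRecordOfRecord₁₃CSep {F : T4Family} {D : Datum F N} {w : DagBinding.WorldP} (hR : IsRecordOfRecord₁₃CSep F N D w)
    (g₀ : ℕ → ℝ) (os : List (ULoop F)) :
    SRec₁₃Sep (canonReading₁₃Sep cr) F D g₀ os
      (cr F (Node00.isDatumOfRecord₁₃CSep_of_isRecordOfRecord₁₃CSep hR).params (Node00.isDatumOfRecord₁₃CSep_of_isRecordOfRecord₁₃CSep hR).provisos g₀ os) :=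
  (sRec₁₃Sep_canon_iff cr D g₀ os _).mpr ⟨Node00.isDatumOfRecord₁₃CSep_of_isRecordOfRecord₁₃CSep hR, rfl⟩

end Canon

end YMDAG.UVSplit
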